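import Literature.NumberTheory.EllipticCurves.PrimaryTorsionGaloisRep
import Literature.NumberTheory.IwasawaTheory.PruferPontryaginDual
import Literature.NumberTheory.EllipticCurves.SkinnerUrban2014.CofinitelyGeneratedSelmerProofs
import Literature.NumberTheory.IwasawaTheory.Greenberg2006.CoinducedModuleDual
import Literature.NumberTheory.EllipticCurves.IsogenyMulProofs
import Literature.NumberTheory.EllipticCurves.PointDivisibilityProofs
import Mathlib.LinearAlgebra.FreeModule.PID
import HarnessLib

/-!
# Crux `AnticyclotomicEisensteinDivisibility` (stmt-BirchSwinnertonDyer-20727), line `bdpline`, stub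
# `stub_finiteExponentSS`, Greenberg-2016 road: instance brick (R1a) — **`E[p^∞]` is COFREE over `ℤ_p`
# and has a finite free TATE DUAL `Hom(E[p^∞], K̄ˣ)`** (helper for stmt-BirchSwinnertonDyer-20727)

Cell `bsd-ssimc` (hosting route `SignedBaseChange`), extra width seat `bsd-line-sbc-p1-w3` (gen 0).
The width seat `bsd-line-sbc-p1-w2` (gen 3) assembled the Greenberg 2016 Prop. 4.1.1 road for
`stub_finiteExponentSS` end to end (`…AlmostDivisibleAssembly`, p627029), GRANTED six published facts,
the line's torsion input and TWO instance bricks. This file PROVES the first brick (R1a), i.e. exactly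
the two displayed hypotheses `hcofree` and `hTate` of
`SignedBaseChangeAcDivAssembly.fullAtSelmer_isAlmostDivisible_curve`, for EVERY elliptic curve over EVERY
field (of characteristic `0` for the Tate dual), with no hypothesis left:

* `isCofree_primaryTorsion` — **`IsCofree ℤ_[p] (PrimaryTorsion W.geomPoints p)`**: every Pontryagin
  dual of `E[p^∞] = E(F̄)[p^∞]` is a finite free `ℤ_p`-module. Proof: the character module
  `Hom(E[p^∞], ℚ/ℤ)` is finitely generated (`E[p^∞]` is `p`-primary with FINITE `p`-torsion `E[p]`,
  Silverman III.6.4, and the tree's topological Nakayama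
  `SkinnerUrban2014.module_finite_characterModule_of_torsion_finite`) and TORSION-FREE (`E(F̄)` is
  divisible, Silverman §VIII.2 / the tree's `zsmul_geomPoints_surjective_holds`, so `c • E[p^∞] = E[p^∞]`
  for every `c ≠ 0` in `ℤ_p`), hence free (`ℤ_p` is a PID, Mathlib
  `Module.free_of_finite_type_torsion_free'`); cofreeness is read on one dual datum
  (`Greenberg2016.isCofree_of_isDualPairing`).
* `exists_tateDual_basis_primaryTorsion` — **a Tate dual `Hom(E[p^∞], K̄ˣ)` with a finite `ℤ_p`-basis**,
  in the shape of `hTate`: the character module is ALSO a `K̄ˣ`-valued dual datum, through the Prüfer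
  embeddings `ℚ_p/ℤ_p ↪ ℚ/ℤ` and `ℚ_p/ℤ_p ↪ K̄ˣ` of the tree (`QpModZp.exists_injective_character`,
  `QpModZp.exists_injective_units`), whose images contain ALL `p`-power torsion of the targets (counting,
  `mem_range_of_pow_nsmul_eq_zero`), so that `Hom(A, ℚ/ℤ) = Hom(A, (ℚ/ℤ)[p^∞]) ≅ Hom(A, μ_{p^∞}) =
  Hom(A, K̄ˣ)` for a `p`-primary `A` (`exists_isDualPairing_characterModule_of_injective`).

§1–§3 are generic (`p`-primary `ℤ_p`-modules, any target group with the `p^n`-torsion bound); §4 is the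
elliptic-curve instance. Theorems only; no definition, no named fact, no `sorry`, standard axioms.
HONEST FRAMING: pure `ℤ_p`-module algebra plus two tree theorems on `E(F̄)` (finiteness of `E[p]`,
divisibility); closes nothing by itself (`--supports stmt-BirchSwinnertonDyer-20727`): with it the
hypotheses of p627029 shrink to {6 PUB facts, `stub_torsionSS`, brick (R1b) LOC⁽¹⁾}. No summit statement
/ BSD is proved by this file.

References: [Greenberg2006] R. Greenberg, Doc. Math. Extra Vol. Coates (2006), p. 338 L15–16
("`T* = Hom(D, μ_{p^∞})` … is a free `R`-module of rank `n`") and p. 342 L5–11; [Greenberg2016Selmer]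
§2 p. 5 L15–17 ("`𝐃` is a cofree `R`-module"); [SilvermanAEC2009] Cor. III.6.4 (`E[m]` finite,
`≅ (ℤ/m)²`), III.§7 (`T_ℓ E`, `E[ℓ^∞]`), §VIII.2 (`0 → E[m] → E(K̄) → E(K̄) → 0`); [GreenbergLNM1716] §4,
proof of Prop. 4.10 (`X/𝔪X` finite ⇒ `X` finitely generated for a Pontryagin dual `X`).
-/

set_option autoImplicit false
set_option linter.dupNamespace false

noncomputable section

open scoped Classical

open Literature.NumberTheory.EllipticCurves Literature.NumberTheory.IwasawaTheory
  Literature.NumberTheory.IwasawaTheory.Greenberg2016 Literature.NumberTheory.GaloisRepresentations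

universe u

namespace Summit.BirchSwinnertonDyer.BirchSwinnertonDyer.Theorems.SignedBaseChangeAcDivCofree

/-! ## §1 The image of a Prüfer embedding contains all `p`-power torsion -/

section Prufer

variable {p : ℕ} [hp : Fact p.Prime] {C : Type*} [AddCommGroup C]

/-- **Every `p^n`-torsion element of `C` lies in the image of an injective `j : ℚ_p/ℤ_p → C`**, when the
`p^n`-torsion subsets of `C` have at most `p^n` elements (`C = ℚ/ℤ`, `C = K̄ˣ`): the `p^n` distinct
elements `j(k • t_n)`, `k < p^n`, are `p^n`-torsion, so they exhaust it (the counting of the tree's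
`QpModZp.exists_apply_tgen_eq`). [cite: Greenberg2006, p. 338 lines 15–16 (`μ_{p^∞}` as the image of `ℚ_p/ℤ_p`)] -/
theorem mem_range_of_pow_nsmul_eq_zero {j : QpModZp p →+ C} (hj : Function.Injective j)
    (hC : ∀ (n : ℕ) (s : Finset C), (∀ c ∈ s, p ^ n • c = 0) → s.card ≤ p ^ n)
    {c : C} {n : ℕ} (hc : p ^ n • c = 0) : c ∈ j.range := by
  let f : ℕ → C := fun k ↦ j ((k : ℤ_[p]) • QpModZp.tgen p n)
  let s : Finset C := (Finset.range (p ^ n)).image f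
  have hinj : Set.InjOn f (Finset.range (p ^ n) : Set ℕ) := by
    intro k hk k' hk' hkk'
    have h1 := QpModZp.natCast_eq_natCast_of_smul_tgen_eq (hj hkk')
    rw [ZMod.natCast_eq_natCast_iff', Nat.mod_eq_of_lt (Finset.mem_range.mp hk),
      Nat.mod_eq_of_lt (Finset.mem_range.mp hk')] at h1
    exact h1
  have hcard : s.card = p ^ n := by
    rw [Finset.card_image_of_injOn hinj, Finset.card_range]
  have htors : ∀ c' ∈ insert c s, p ^ n • c' = 0 := by
    intro c' hc'
    rcases Finset.mem_insert.mp hc' with rfl | hc'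
    · exact hc
    · obtain ⟨k, -, rfl⟩ := Finset.mem_image.mp hc'
      change p ^ n • j ((k : ℤ_[p]) • QpModZp.tgen p n) = 0
      rw [← map_nsmul, smul_comm, QpModZp.pow_nsmul_tgen, smul_zero, map_zero]
  by_contra hne
  have hnot : c ∉ s := fun hmem ↦ by
    obtain ⟨k, -, hk⟩ := Finset.mem_image.mp hmem
    exact hne ⟨_, hk⟩
  have := hC n _ htors
  rw [Finset.card_insert_of_notMem hnot, hcard] at this
  omega

/-- For a `p`-PRIMARY source `A`, every additive map `A → C` takes values in the image of an injective
Prüfer embedding `j : ℚ_p/ℤ_p → C` (targets with the `p^n`-torsion bound).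
[cite: Greenberg2006, p. 338 lines 15–16 (`Hom(D, K̄ˣ) = Hom(D, μ_{p^∞})`)] -/
theorem apply_mem_range_of_pPrimary {A : Type*} [AddCommGroup A]
    (hA : ∀ a : A, ∃ k : ℕ, p ^ k • a = 0) {j : QpModZp p →+ C} (hj : Function.Injective j)
    (hC : ∀ (n : ℕ) (s : Finset C), (∀ c ∈ s, p ^ n • c = 0) → s.card ≤ p ^ n)
    (f : A →+ C) (a : A) : f a ∈ j.range := by
  obtain ⟨k, hk⟩ := hA a
  exact mem_range_of_pow_nsmul_eq_zero hj hC (n := k) (by rw [← map_nsmul, hk, map_zero])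

end Prufer

/-! ## §2 The character module of a `p`-primary module is a `C`-valued dual datum for every Prüfer target `C` -/

section Transfer

variable {p : ℕ} [hp : Fact p.Prime]

/-- **`Hom(A, ℚ/ℤ) ≅ Hom(A, C)` as balanced duals of a `p`-primary `ℤ_p`-module `A`**, for any group `C`
receiving an injective `j_C : ℚ_p/ℤ_p → C` and satisfying the `p^n`-torsion bound (`C = K̄ˣ`: the Tate
dual `Hom(A, μ_{p^∞})`): there is an additive bijection `tA : CharacterModule A → Hom(A, C)` with
`tA (c • χ) a = tA χ (c • a)` (`Greenberg2016.IsDualPairing ℤ_[p] A tA`). Construction: a character `χ`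
lands in `(ℚ/ℤ)[p^∞] = j_Q(ℚ_p/ℤ_p)` for an injective character `j_Q` of `ℚ_p/ℤ_p` (§1), and
`tA χ = j_C ∘ j_Q⁻¹ ∘ χ`. [cite: Greenberg2006, p. 338 lines 15–16 (`T* = Hom(D, μ_{p^∞})` free of rank `n`)]
[cite: Greenberg2016Selmer, §1 p. 2 L17–35 and §2 p. 5 L15–35 (Pontryagin and Tate duals)] -/
theorem exists_isDualPairing_characterModule_of_injective {A : Type} [AddCommGroup A] [Module ℤ_[p] A]
    (hA : ∀ a : A, ∃ k : ℕ, p ^ k • a = 0) {C : Type*} [AddCommGroup C] {jC : QpModZp p →+ C}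
    (hjC : Function.Injective jC)
    (hC : ∀ (n : ℕ) (s : Finset C), (∀ c ∈ s, p ^ n • c = 0) → s.card ≤ p ^ n) :
    ∃ tA : CharacterModule A →+ (A →+ C), IsDualPairing ℤ_[p] A tA := by
  obtain ⟨jQ, hjQ⟩ := QpModZp.exists_injective_character (p := p)
  have hQ := QpModZp.addCircle_torsionBound (p := p)
  -- every character of `A` lands in `jQ (ℚ_p/ℤ_p)`, every `A → C` in `jC (ℚ_p/ℤ_p)`
  have hmemQ : ∀ (χ : CharacterModule A) (a : A), χ a ∈ jQ.range := fun χ a ↦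
    apply_mem_range_of_pPrimary hA hjQ hQ (χ : A →+ AddCircle (1 : ℚ)) a
  have hmemC : ∀ (f : A →+ C) (a : A), f a ∈ jC.range := fun f a ↦
    apply_mem_range_of_pPrimary hA hjC hC f a
  let eQ : QpModZp p ≃+ jQ.range := AddMonoidHom.ofInjective hjQ
  let eC : QpModZp p ≃+ jC.range := AddMonoidHom.ofInjective hjC
  -- the transfer `Φ χ = jC ∘ jQ⁻¹ ∘ χ`
  let Φ : CharacterModule A → (A →+ C) := fun χ ↦
    jC.comp (eQ.symm.toAddMonoidHom.comp
      (AddMonoidHom.codRestrict (χ : A →+ AddCircle (1 : ℚ)) jQ.range (hmemQ χ)))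
  -- its characterisation: `Φ χ a = jC y` whenever `jQ y = χ a`
  have hΦ : ∀ (χ : CharacterModule A) (a : A) (y : QpModZp p), jQ y = χ a → Φ χ a = jC y := by
    intro χ a y hy
    change jC (eQ.symm ⟨χ a, hmemQ χ a⟩) = jC y
    congr 1
    apply hjQ
    rw [AddMonoidHom.apply_ofInjective_symm hjQ]
    exact hy.symm
  have hex : ∀ (χ : CharacterModule A) (a : A), ∃ y : QpModZp p, jQ y = χ a := fun χ a ↦ by
    obtain ⟨y, hy⟩ := hmemQ χ a
    exact ⟨y, hy⟩
  have h0 : Φ 0 = 0 := by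
    ext a
    rw [hΦ 0 a 0 (by rw [map_zero]; rfl), map_zero, AddMonoidHom.zero_apply]
  have hadd : ∀ χ ψ : CharacterModule A, Φ (χ + ψ) = Φ χ + Φ ψ := by
    intro χ ψ
    ext a
    obtain ⟨y₁, hy₁⟩ := hex χ a
    obtain ⟨y₂, hy₂⟩ := hex ψ a
    rw [AddMonoidHom.add_apply, hΦ χ a y₁ hy₁, hΦ ψ a y₂ hy₂, ← map_add,
      hΦ (χ + ψ) a (y₁ + y₂) (by rw [map_add, hy₁, hy₂]; rfl)]
  let T : CharacterModule A →+ (A →+ C) := { toFun := Φ, map_zero' := h0, map_add' := hadd }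
  have hT : ∀ χ, T χ = Φ χ := fun _ ↦ rfl
  refine ⟨T, ⟨?_, ?_⟩, ?_⟩
  · -- injective
    intro χ ψ h
    apply DFunLike.ext
    intro a
    obtain ⟨y₁, hy₁⟩ := hex χ a
    obtain ⟨y₂, hy₂⟩ := hex ψ a
    have h' : Φ χ a = Φ ψ a := by rw [← hT, ← hT, h]
    rw [hΦ χ a y₁ hy₁, hΦ ψ a y₂ hy₂] at h'
    rw [← hy₁, ← hy₂, hjC h']
  · -- surjective
    intro f
    let χ : CharacterModule A :=
      jQ.comp (eC.symm.toAddMonoidHom.comp (AddMonoidHom.codRestrict f jC.range (hmemC f)))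
    refine ⟨χ, ?_⟩
    ext a
    rw [hT]
    rw [hΦ χ a (eC.symm ⟨f a, hmemC f a⟩) rfl, AddMonoidHom.apply_ofInjective_symm hjC]
  · -- balanced: `Φ (c • χ) a = Φ χ (c • a)`
    intro c χ a
    rw [hT, hT]
    obtain ⟨y, hy⟩ := hex χ (c • a)
    rw [hΦ χ (c • a) y hy, hΦ (c • χ) a y (by rw [hy, CharacterModule.smul_apply])]

/-- The same with a FINITE BASIS: if the character module of the `p`-primary `A` is finite free over
`ℤ_p`, then `A` has a `C`-valued dual datum with a `ℤ_p`-basis indexed by `Fin n` — the shape of the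
Tate-dual hypothesis `hTate` of `SignedBaseChangeAcDivAssembly.fullAtSelmer_isAlmostDivisible_curve`.
[cite: Greenberg2006, p. 338 lines 15–16 (`T* = Hom(D, μ_{p^∞})` free of rank `n`)] -/
theorem exists_dual_basis_of_free {A : Type} [AddCommGroup A] [Module ℤ_[p] A]
    (hA : ∀ a : A, ∃ k : ℕ, p ^ k • a = 0) [Module.Free ℤ_[p] (CharacterModule A)]
    [Module.Finite ℤ_[p] (CharacterModule A)] {C : Type*} [AddCommGroup C] {jC : QpModZp p →+ C}
    (hjC : Function.Injective jC)
    (hC : ∀ (n : ℕ) (s : Finset C), (∀ c ∈ s, p ^ n • c = 0) → s.card ≤ p ^ n) :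
    ∃ (Y : Type) (_ : AddCommGroup Y) (_ : Module ℤ_[p] Y) (tA : Y →+ (A →+ C))
      (_ : IsDualPairing ℤ_[p] A tA) (n : ℕ), Nonempty (Module.Basis (Fin n) ℤ_[p] Y) := by
  obtain ⟨tA, htA⟩ := exists_isDualPairing_characterModule_of_injective hA hjC hC
  let b := Module.Free.chooseBasis ℤ_[p] (CharacterModule A)
  exact ⟨CharacterModule A, inferInstance, inferInstance, tA, htA,
    Fintype.card (Module.Free.ChooseBasisIndex ℤ_[p] (CharacterModule A)),
    ⟨b.reindex (Fintype.equivFin _)⟩⟩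

end Transfer

/-! ## §3 Divisible `p`-primary modules have torsion-free character modules -/

section Divisible

variable {p : ℕ} [hp : Fact p.Prime] {A : Type} [AddCommGroup A] [Module ℤ_[p] A]

/-- A `p`-divisible `ℤ_p`-module is `c`-divisible for every `c ≠ 0` (`c = u · p^n`, `u` a unit).
[cite: SilvermanAEC2009, §VIII.2 (divisibility of `E(K̄)`)] -/
theorem exists_smul_eq_of_pDivisible (hdiv : ∀ a : A, ∃ b : A, (p : ℤ_[p]) • b = a) {c : ℤ_[p]}
    (hc : c ≠ 0) (a : A) : ∃ b : A, c • b = a := by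
  have hpow : ∀ (n : ℕ) (a : A), ∃ b : A, (p : ℤ_[p]) ^ n • b = a := by
    intro n
    induction n with
    | zero => exact fun a ↦ ⟨a, by rw [pow_zero, one_smul]⟩
    | succ n ih =>
      intro a
      obtain ⟨b, hb⟩ := ih a
      obtain ⟨b', hb'⟩ := hdiv b
      exact ⟨b', by rw [pow_succ, mul_smul, hb', hb]⟩
  obtain ⟨b, hb⟩ := hpow c.valuation a
  have hcu := PadicInt.unitCoeff_spec hc
  refine ⟨((PadicInt.unitCoeff hc)⁻¹ : ℤ_[p]ˣ) • b, ?_⟩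
  calc c • (((PadicInt.unitCoeff hc)⁻¹ : ℤ_[p]ˣ) • b)
      = ((PadicInt.unitCoeff hc : ℤ_[p]) * (p : ℤ_[p]) ^ c.valuation) •
          (((PadicInt.unitCoeff hc)⁻¹ : ℤ_[p]ˣ) • b) := by rw [← hcu]
    _ = a := by
        rw [Units.smul_def, ← mul_smul, mul_assoc, mul_comm ((p : ℤ_[p]) ^ c.valuation), ← mul_assoc,
          Units.mul_inv, one_mul, hb]

/-- **The character module of a `p`-DIVISIBLE `ℤ_p`-module is torsion-free**: if `c • χ = 0` with
`c ≠ 0` then `χ(a) = χ(c • a') = (c • χ)(a') = 0` for every `a = c • a'`.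
[cite: GreenbergLNM1716, §4, proof of Prop. 4.10 (duals of divisible groups are torsion-free)] -/
theorem isTorsionFree_characterModule_of_pDivisible
    (hdiv : ∀ a : A, ∃ b : A, (p : ℤ_[p]) • b = a) :
    Module.IsTorsionFree ℤ_[p] (CharacterModule A) := by
  refine Module.IsTorsionFree.of_smul_eq_zero fun c χ h ↦ ?_
  by_cases hc : c = 0
  · exact Or.inl hc
  refine Or.inr ?_
  apply DFunLike.ext
  intro a
  obtain ⟨b, rfl⟩ := exists_smul_eq_of_pDivisible hdiv hc a
  rw [← CharacterModule.smul_apply, h]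
  rfl

/-- **Cofreeness from divisibility and cofinite generation**: a `p`-divisible `ℤ_p`-module whose
character module is finitely generated is COFREE (every Pontryagin dual finite free): torsion-free
finitely generated modules over the PID `ℤ_p` are free. [cite: Greenberg2006, p. 338 lines 15–16 and p. 342 L5–11 (`D` cofree)]
[cite: Greenberg2016Selmer, §2 p. 5 L15–17] -/
theorem isCofree_of_pDivisible (hdiv : ∀ a : A, ∃ b : A, (p : ℤ_[p]) • b = a)
    [Module.Finite ℤ_[p] (CharacterModule A)] : IsCofree ℤ_[p] A := by
  haveI := isTorsionFree_characterModule_of_pDivisible hdiv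
  haveI : Module.Free ℤ_[p] (CharacterModule A) := Module.free_of_finite_type_torsion_free'
  exact isCofree_of_isDualPairing (isDualPairing_characterModule ℤ_[p] A)

end Divisible

/-! ## §4 The instance `A = E[p^∞] = PrimaryTorsion W.geomPoints p` -/

section Curve

variable {F : Type} [Field F] (W : WeierstrassCurve F) (p : ℕ) [hp : Fact p.Prime]

omit hp in
/-- `E[p^∞]` is `p`-primary as a `ℤ_p`-module (natural multiples). [cite: SilvermanAEC2009, III.§7 (`E[ℓ^∞] = ⋃ E[ℓⁿ]`)] -/
theorem primaryTorsion_exists_pow_nsmul_eq_zero (a : PrimaryTorsion W.geomPoints p) :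
    ∃ k : ℕ, p ^ k • a = 0 := by
  obtain ⟨k, hk⟩ := a.exists_pow_smul_eq_zero
  exact ⟨k, PrimaryTorsion.ext (by rw [PrimaryTorsion.val_nsmul]; exact hk)⟩

/-- `E[p^∞]` is `p`-primary for the `ℤ_p`-scalar `p`. [cite: SilvermanAEC2009, III.§7 (`E[ℓ^∞] = ⋃ E[ℓⁿ]`)] -/
theorem primaryTorsion_exists_pow_smul_eq_zero (a : PrimaryTorsion W.geomPoints p) :
    ∃ k : ℕ, (p : ℤ_[p]) ^ k • a = 0 := by
  obtain ⟨k, hk⟩ := primaryTorsion_exists_pow_nsmul_eq_zero W p a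
  exact ⟨k, by rw [← Nat.cast_pow, PrimaryTorsion.natCast_smul, hk]⟩

/-- **`E[p^∞]` is `p`-divisible** for an elliptic curve: `E(F̄)` is divisible (the tree's
`zsmul_geomPoints_surjective_holds`, Silverman §VIII.2), and a `p`-th root of a `p`-power torsion point is
`p`-power torsion. [cite: SilvermanAEC2009, §VIII.2 (`0 → E[m] → E(K̄) → E(K̄) → 0`)] -/
theorem primaryTorsion_pDivisible [W.IsElliptic] (a : PrimaryTorsion W.geomPoints p) :
    ∃ b : PrimaryTorsion W.geomPoints p, (p : ℤ_[p]) • b = a := by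
  obtain ⟨k, hk⟩ := a.exists_pow_smul_eq_zero
  have hp0 : (p : ℤ) ≠ 0 := Nat.cast_ne_zero.mpr hp.out.ne_zero
  obtain ⟨Q, hQ⟩ := W.zsmul_geomPoints_surjective_holds hp0 (a : W.geomPoints)
  change (p : ℤ) • Q = (a : W.geomPoints) at hQ
  rw [natCast_zsmul] at hQ
  have hQk : p ^ (k + 1) • Q = 0 := by
    rw [pow_succ, mul_smul, hQ, hk]
  refine ⟨PrimaryTorsion.mk Q (k + 1) hQk, PrimaryTorsion.ext ?_⟩
  rw [PrimaryTorsion.natCast_smul, PrimaryTorsion.val_nsmul, PrimaryTorsion.val_mk, hQ]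

/-- **`E[p^∞][p] = E[p]` is finite** (Silverman Cor. III.6.4, tree `finite_geomTorsion`).
[cite: SilvermanAEC2009, Cor. III.6.4] -/
theorem primaryTorsion_torsionBy_finite [W.IsElliptic] :
    {d : PrimaryTorsion W.geomPoints p | (p : ℤ_[p]) • d = 0}.Finite := by
  have hp0 : (p : ℤ) ≠ 0 := Nat.cast_ne_zero.mpr hp.out.ne_zero
  have hfin := W.finite_geomTorsion hp0
  have hinj : Set.InjOn (fun d : PrimaryTorsion W.geomPoints p ↦ (d : W.geomPoints))
      ((fun d : PrimaryTorsion W.geomPoints p ↦ (d : W.geomPoints)) ⁻¹'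
        (W.geomTorsion (p : ℤ) : Set W.geomPoints)) :=
    fun _ _ _ _ h ↦ PrimaryTorsion.ext h
  refine (hfin.preimage hinj).subset fun d hd ↦ ?_
  change (p : ℤ_[p]) • d = 0 at hd
  change (d : W.geomPoints) ∈ (W.geomTorsion (p : ℤ) : Set W.geomPoints)
  rw [SetLike.mem_coe]
  refine (Submodule.mem_torsionBy_iff (p : ℤ) _).mpr ?_
  rw [natCast_zsmul, ← PrimaryTorsion.val_nsmul, ← PrimaryTorsion.natCast_smul, hd, PrimaryTorsion.val_zero]

/-- **`E[p^∞]` is cofinitely generated**: `Hom(E[p^∞], ℚ/ℤ)` is a finitely generated `ℤ_p`-module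
(topological Nakayama, tree `SkinnerUrban2014.module_finite_characterModule_of_torsion_finite`).
[cite: GreenbergLNM1716, §4, proof of Prop. 4.10] [cite: SilvermanAEC2009, Cor. III.6.4] -/
theorem module_finite_characterModule_primaryTorsion [W.IsElliptic] :
    Module.Finite ℤ_[p] (CharacterModule (PrimaryTorsion W.geomPoints p)) :=
  SkinnerUrban2014.module_finite_characterModule_of_torsion_finite
    (primaryTorsion_exists_pow_smul_eq_zero W p) (primaryTorsion_torsionBy_finite W p)

/-- `Hom(E[p^∞], ℚ/ℤ)` is torsion-free over `ℤ_p` (divisibility of `E(F̄)`).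
[cite: SilvermanAEC2009, §VIII.2] [cite: GreenbergLNM1716, §4, proof of Prop. 4.10] -/
theorem isTorsionFree_characterModule_primaryTorsion [W.IsElliptic] :
    Module.IsTorsionFree ℤ_[p] (CharacterModule (PrimaryTorsion W.geomPoints p)) :=
  isTorsionFree_characterModule_of_pDivisible (primaryTorsion_pDivisible W p)

/-- **`Hom(E[p^∞], ℚ/ℤ)` is a FREE `ℤ_p`-module** (Silverman III.7: it is `T_p`-like, free of rank
two; here only freeness is recorded). [cite: SilvermanAEC2009, Prop. III.7.1 (`T_ℓ E` free over `ℤ_ℓ`)]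
[cite: Greenberg2006, p. 338 lines 15–16] -/
theorem module_free_characterModule_primaryTorsion [W.IsElliptic] :
    Module.Free ℤ_[p] (CharacterModule (PrimaryTorsion W.geomPoints p)) := by
  haveI := module_finite_characterModule_primaryTorsion W p
  haveI := isTorsionFree_characterModule_primaryTorsion W p
  exact Module.free_of_finite_type_torsion_free'

/-- **Brick (R1a), first half: `E[p^∞]` is COFREE over `ℤ_p`** — the hypothesis `hcofree :
IsCofree ℤ_[p] (PrimaryTorsion W.geomPoints p)` of
`SignedBaseChangeAcDivAssembly.fullAtSelmer_isAlmostDivisible_curve` (p627029), for every elliptic curve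
over every field. [cite: Greenberg2006, p. 342 L5–11 (`𝒟` cofree)] [cite: Greenberg2016Selmer, §2 p. 5 L15–17, §4.1 p. 15 L28 (`𝐃` cofree)]
[cite: SilvermanAEC2009, Cor. III.6.4, §VIII.2] -/
theorem isCofree_primaryTorsion [W.IsElliptic] : IsCofree ℤ_[p] (PrimaryTorsion W.geomPoints p) := by
  haveI := module_finite_characterModule_primaryTorsion W p
  exact isCofree_of_pDivisible (primaryTorsion_pDivisible W p)

/-- **Brick (R1a), second half: a TATE DUAL `Hom(E[p^∞], K̄ˣ)` with a finite `ℤ_p`-basis** — the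
hypothesis `hTate` of `SignedBaseChangeAcDivAssembly.fullAtSelmer_isAlmostDivisible_curve` (p627029), for
every elliptic curve over every field of characteristic `0` (so that `K̄ˣ ⊇ μ_{p^∞} ≅ ℚ_p/ℤ_p`, tree
`QpModZp.exists_injective_units`). [cite: Greenberg2006, p. 338 lines 15–16 (`T* = Hom(D, μ_{p^∞})` free of rank `n`)]
[cite: Greenberg2016Selmer, §2 p. 5 L15–35] -/
theorem exists_tateDual_basis_primaryTorsion [CharZero F] [W.IsElliptic] :
    ∃ (Y : Type) (_ : AddCommGroup Y) (_ : Module ℤ_[p] Y)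
      (tA : Y →+ (PrimaryTorsion W.geomPoints p →+ DiscreteGaloisModule.UnitsCarrier F))
      (_ : IsDualPairing ℤ_[p] (PrimaryTorsion W.geomPoints p) tA) (n : ℕ),
      Nonempty (Module.Basis (Fin n) ℤ_[p] Y) := by
  haveI := module_finite_characterModule_primaryTorsion W p
  haveI := module_free_characterModule_primaryTorsion W p
  haveI : CharZero (AlgebraicClosure F) :=
    charZero_of_injective_algebraMap (algebraMap F (AlgebraicClosure F)).injective
  haveI : NeZero (p : AlgebraicClosure F) := ⟨Nat.cast_ne_zero.mpr hp.out.ne_zero⟩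
  obtain ⟨j, hj⟩ := QpModZp.exists_injective_units (p := p) (AlgebraicClosure F)
  let jC : QpModZp p →+ DiscreteGaloisModule.UnitsCarrier F :=
    (DiscreteGaloisModule.UnitsCarrier.toAdditive (K := F)).symm.toAddMonoidHom.comp j
  have hjC : Function.Injective jC :=
    (DiscreteGaloisModule.UnitsCarrier.toAdditive (K := F)).symm.injective.comp hj
  exact exists_dual_basis_of_free (primaryTorsion_exists_pow_nsmul_eq_zero W p) hjC
    (QpModZp.unitsCarrier_torsionBound F)

end Curve

end Summit.BirchSwinnertonDyer.BirchSwinnertonDyer.Theorems.SignedBaseChangeAcDivCofree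

end
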